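import Literature.Analysis.ValidatedNumerics.TaylorModelIntegralCert2DTrig
import Literature.Analysis.ValidatedNumerics.TaylorModelExpr
import HarnessLib

/-!
# Partial (strip) integration of bivariate Taylor models: integrals depending on a parameter, enclosed to HIGH ORDER
# in the parameter by a univariate Taylor model

Trunk T-ANA (Analysis/ValidatedNumerics); namespace `Literature.Analysis.ValidatedNumerics.PolyMP`.
Sequel of `TaylorModelBivariate.lean` (bivariate Taylor models `TMem2 S h k f P` on `|ρ| ≤ h, |σ| ≤ k`, range bound `tabs2`),
`TaylorModelIntegralCert2D.lean` (Makino–Berz Algorithm 2: the rational midpoint rows `midRows`, their exact row integrals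
`integRowQ` / `integral_evalR2_ratRows`, the box estimate) and `TaylorModelIntegralCert2DTrig.lean` (the code list `BExprT` with
its box modeller `BExprT.model` / `tmem2_model`).  Those files integrate over BOTH variables.  Here only the SECOND variable is
integrated: step 3 of op. cit. Algorithm 2 ("the polynomial part is integrated exactly by manipulating coefficients") applied to
the rows `Σᵢ ρⁱ pᵢ(σ)` of a bivariate model yields the polynomial `Σᵢ (∫_{-k}^{k} pᵢ) ρⁱ` IN THE REMAINING VARIABLE, and the
remainder of the box model, integrated over `σ` only, is folded into its constant coefficient — so the PARAMETRIC integral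
`ρ ↦ ∫_{-k}^{k} f(ρ, σ) dσ` is enclosed by a univariate Taylor model `TMem S h (·) (partialIntegTM S h k P)` of the SAME order
as the box model (not merely by an interval, as a parameter box of `TaylorModelIntegralCertParam.lean` would give):

* `partialIntegTM S h k P` and **`tmem_partialInteg`**: `TMem2 S h k f P →` (joint measurability) `→`
  `TMem S h (fun ρ => ∫_{-k}^{k} f ρ σ dσ) (partialIntegTM S h k P)`, together with the interval integrability of every
  section `σ ↦ f ρ σ`, `|ρ| ≤ h` (boundedness from the model);
* STRIPS: a column of consecutive `σ`-boxes of arbitrary rational half-widths `ks = [k₀, k₁, …]` starting at `ay` (box `j` is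
  `[aⱼ, aⱼ + 2kⱼ]`, `a₀ = ay`, right end `stripEnd ay ks`), each modelled by a box rule `Φ k cy : IPoly2 × Bool` sound in the
  sense `StripSound S h f Φ` (`(Φ k cy).2 = true → 0 ≤ k → TMem2 S h k (fun u v => f u (cy + v)) (Φ k cy).1`); the strip model
  `stripTM S h Φ ay ks : IPoly × Bool` adds the partial models of the boxes, and **`tmem_stripTM`**:
  `(stripTM …).2 = true → TMem S h (fun ρ => ∫_{ay}^{stripEnd ay ks} f ρ y dy) (stripTM …).1` (additivity of the interval
  integral over adjacent boxes, integrability carried along) — graded (non-uniform) boxes are allowed, so a strip can be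
  refined towards an edge where the integrand is steep;
* the VECTOR form `stripTMs S h n Φ ay ks : List IPoly × Bool` for a rule returning `n` box models at once (several integrands
  sharing sub-expressions are modelled by ONE pass per box) with **`tmem_stripTMs`** (component-wise conclusion);
* PIECEWISE-CERTIFIED strips (`piecesOK`, `sumPieces`, **`tmem_pieces`**): a long strip is split into consecutive pieces, each
  certified by its own kernel equality `stripTMs … aⱼ kssⱼ = (litⱼ, true)` against a literal model list (one `decide` per piece,
  so that no single declaration exceeds the kernel budget), and the literals are summed component-wise;
* the instance for the code list `BExprT`: `stripTME S h P E cx ay ks` and **`tmem_stripTME`**: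
  `(stripTME …).2 = true → TMem S h (fun ρ => ∫_{ay}^{stripEnd ay ks} E(cx + ρ, y) dy) (stripTME …).1` — no side hypotheses;
  the range of the parametric integral on `|ρ| ≤ h` is then read by `bounds_of_tmem` / `tlowerI` / `tupperI`, and several such
  models on the same `ρ`-panel combine by the univariate arithmetic `taddI` / `tmulI` / `tsmulI` of `TaylorModel.lean`.

Use: integrals of a smooth kernel over a period / a flux surface / a Feynman parameter that must be bounded UNIFORMLY — and
compared, multiplied, differenced — as functions of a physical parameter (a radius, a coupling, an energy); the panel in the
parameter can be as wide as the analyticity of the kernel allows, instead of as narrow as a zero-order box requires.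
Problem-independent; no facts, no axioms; all data computable over `ℤ`.

## References

* K. Makino, M. Berz, *Taylor models and other validated functional inclusion methods*, Int. J. Pure Appl. Math. 4
  (2003) 379–456: Algorithm 2 (quadrature with Taylor models; step 3: exact integration of the polynomial part "with respect
  to any of the variables"), Sect. 6 (antiderivation `∂⁻¹` as an intrinsic on Taylor models: the integral with respect to one
  variable of a multivariate Taylor model is again a Taylor model). [cite: MakinoBerz2003, Algorithm 2]
* M. Berz, K. Makino, *New methods for high-dimensional verified quadrature*, Reliable Computing 5 (1999) 13–22, Sect. 2
  (partial integration of the polynomial part, remainder bound times the measure of the sub-box). [cite: BerzMakino1999, Sect. 2]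
* A. Mahboubi, G. Melquiond, T. Sibut-Pinote, *Formally verified approximations of definite integrals*, ITP 2016, LNCS 9807,
  274–289, Sect. 3.3 (splitting the domain, adding the enclosures of the pieces). [cite: MahboubiMelquiondSibutpinote2016, Sect. 3.3]
-/

open MeasureTheory intervalIntegral Set
open scoped Interval

namespace Literature.Analysis.ValidatedNumerics

namespace PolyMP

open Literature.Analysis.ValidatedNumerics.NumericsMP
open Literature.Analysis.ValidatedNumerics.ExpPoly (Poly)
open Literature.Analysis.ValidatedNumerics.ExpPoly

/-! ### One box: the partial integral over `σ` as a Taylor model in `ρ` -/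

/-- **The partial-integral Taylor model.**  From a bivariate model `P` of `f` on `|ρ| ≤ h, |σ| ≤ k`: the rational midpoint rows
`pᵢ` integrated exactly over `σ ∈ [-k, k]` give the polynomial `Σᵢ (∫pᵢ) ρⁱ` (thin coefficients), and the constant coefficient
is widened by `⌈2k · tabs2(P − p)⌉` (the remainder of the box model integrated over `σ` only).
[cite: MakinoBerz2003, Algorithm 2] -/
def partialIntegTM (S : ℕ) (h k : ℚ) (P : IPoly2) : IPoly :=
  widen0 (ratPolyI S ((midRows S P).map fun r => integRowQ r k))
    ⌈(tabs2 S h k (tsub2 P (ratPoly2 S (midRows S P))) : ℚ) * (2 * k)⌉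

/-- [folklore] -/
private theorem intervalIntegrable_of_abs_le' {g : ℝ → ℝ} (hg : Measurable g) {k : ℚ} (k0 : 0 ≤ k) {M : ℝ}
    (hb : ∀ σ : ℝ, |σ| ≤ k → |g σ| ≤ M) : IntervalIntegrable g volume (-(k : ℝ)) k := by
  have hk : (0 : ℝ) ≤ k := by exact_mod_cast k0
  have hle : (-(k : ℝ)) ≤ k := by linarith
  rw [intervalIntegrable_iff_integrableOn_Icc_of_le hle]
  refine Measure.integrableOn_of_bounded (M := M)
    (by rw [Real.volume_Icc]; exact ENNReal.ofReal_ne_top) hg.aestronglyMeasurable ?_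
  refine (ae_restrict_iff' measurableSet_Icc).2 (Filter.Eventually.of_forall fun x hx => ?_)
  rw [Real.norm_eq_abs]
  exact hb x (abs_le.2 ⟨hx.1, hx.2⟩)

/-- [folklore] -/
private theorem continuous_evalR_row' (as : List ℝ) : Continuous (evalR as) :=
  continuous_iff_continuousAt.2 fun x => (hasDerivAt_evalR as x).continuousAt

/-- [folklore] -/
private theorem continuous_evalR2_right' : ∀ (p : List (List ℝ)) (ρ : ℝ), Continuous fun σ => evalR2 p ρ σ
  | [], _ => by simpa using continuous_const
  | r :: rs, ρ => by
      simp only [evalR2_cons]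
      exact (continuous_evalR_row' r).add (continuous_const.mul (continuous_evalR2_right' rs ρ))

/-- **Soundness of the partial-integral model** (op. cit. Algorithm 2, step 3 in one variable, step 4 for the remainder):
if `P` encloses a jointly measurable `f` on `|ρ| ≤ h, |σ| ≤ k`, then `ρ ↦ ∫_{-k}^{k} f ρ σ dσ` is enclosed by
`partialIntegTM S h k P` on `|ρ| ≤ h`, and every section `σ ↦ f ρ σ` (`|ρ| ≤ h`) is interval integrable on `[-k, k]`.
[cite: MakinoBerz2003, Algorithm 2] -/
theorem tmem_partialInteg {S : ℕ} (hS : 0 < S) {h k : ℚ} (h0 : 0 ≤ h) (k0 : 0 ≤ k) {f : ℝ → ℝ → ℝ}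
    (hm : Measurable fun z : ℝ × ℝ => f z.1 z.2) {P : IPoly2} (hf : TMem2 S h k f P) :
    TMem S h (fun ρ => ∫ σ in (-(k : ℝ))..k, f ρ σ) (partialIntegTM S h k P) ∧
      ∀ ρ : ℝ, |ρ| ≤ h → IntervalIntegrable (fun σ => f ρ σ) volume (-(k : ℝ)) k := by
  have hSr : (0 : ℝ) < S := by exact_mod_cast hS
  have hkr : (0 : ℝ) ≤ k := by exact_mod_cast k0
  have hkk : (-(k : ℝ)) ≤ k := by linarith
  set p : List Poly := midRows S P with hp
  -- pointwise bounds from the models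
  have hA : ∀ ρ σ : ℝ, |ρ| ≤ h → |σ| ≤ k → |f ρ σ| ≤ (tabs2 S h k P : ℝ) / S := fun ρ σ hρ hσ => by
    rw [le_div_iff₀ hSr]; exact abs_le_tabs2 h0 k0 hf hρ hσ
  have hdiff := tmem2_sub hf (tmem2_ratPoly2 S h k p)
  have hD : ∀ ρ σ : ℝ, |ρ| ≤ h → |σ| ≤ k →
      |f ρ σ - evalR2 (ratRows p) ρ σ| ≤ (tabs2 S h k (tsub2 P (ratPoly2 S p)) : ℝ) / S := fun ρ σ hρ hσ => by
    rw [le_div_iff₀ hSr]; exact abs_le_tabs2 h0 k0 hdiff hρ hσ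
  -- sections are measurable and integrable
  have hsec : ∀ ρ : ℝ, Measurable fun σ => f ρ σ := fun ρ => hm.comp measurable_prodMk_left
  have hIσ : ∀ ρ : ℝ, |ρ| ≤ h → IntervalIntegrable (fun σ => f ρ σ) volume (-(k : ℝ)) k := fun ρ hρ =>
    intervalIntegrable_of_abs_le' (hsec ρ) k0 fun σ hσ => hA ρ σ hρ hσ
  refine ⟨?_, hIσ⟩
  intro ρ hρ
  -- the exact part
  set q : Poly := p.map fun r => integRowQ r k with hq
  have hexact : ∫ σ in (-(k : ℝ))..k, evalR2 (ratRows p) ρ σ = Poly.eval q ρ := integral_evalR2_ratRows p k ρ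
  -- the remainder, integrated over σ only
  set δ : ℝ := (∫ σ in (-(k : ℝ))..k, f ρ σ) - Poly.eval q ρ with hδ
  have hδb : |δ| ≤ (tabs2 S h k (tsub2 P (ratPoly2 S p)) : ℝ) / S * (2 * k) := by
    rw [hδ, ← hexact, ← intervalIntegral.integral_sub (hIσ ρ hρ)
      ((continuous_evalR2_right' _ ρ).intervalIntegrable _ _)]
    have hpt : ∀ σ ∈ Ι (-(k : ℝ)) k, ‖f ρ σ - evalR2 (ratRows p) ρ σ‖ ≤
        (tabs2 S h k (tsub2 P (ratPoly2 S p)) : ℝ) / S := fun σ hσ => by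
      rw [uIoc_of_le hkk] at hσ
      rw [Real.norm_eq_abs]; exact hD ρ σ hρ (abs_le.2 ⟨hσ.1.le, hσ.2⟩)
    have := norm_integral_le_of_norm_le_const hpt
    have e2 : |(k : ℝ) - -(k : ℝ)| = 2 * k := by rw [sub_neg_eq_add, abs_of_nonneg (by positivity)]; ring
    rw [Real.norm_eq_abs, e2] at this
    exact this
  have hδS : |δ| * S ≤ (⌈(tabs2 S h k (tsub2 P (ratPoly2 S p)) : ℚ) * (2 * k)⌉ : ℤ) := by
    have h1 : |δ| * S ≤ (tabs2 S h k (tsub2 P (ratPoly2 S p)) : ℝ) * (2 * k) := by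
      have := mul_le_mul_of_nonneg_right hδb hSr.le
      have e : (tabs2 S h k (tsub2 P (ratPoly2 S p)) : ℝ) / S * (2 * k) * S
          = (tabs2 S h k (tsub2 P (ratPoly2 S p)) : ℝ) * (2 * k) := by
        field_simp
      linarith
    have h2 : ((tabs2 S h k (tsub2 P (ratPoly2 S p)) : ℝ) * (2 * k))
        = (((tabs2 S h k (tsub2 P (ratPoly2 S p)) : ℚ) * (2 * k) : ℚ) : ℝ) := by push_cast; ring
    have h3 : ((((tabs2 S h k (tsub2 P (ratPoly2 S p)) : ℚ) * (2 * k) : ℚ) : ℝ))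
        ≤ ((⌈(tabs2 S h k (tsub2 P (ratPoly2 S p)) : ℚ) * (2 * k)⌉ : ℤ) : ℝ) := by
      have := Int.le_ceil ((tabs2 S h k (tsub2 P (ratPoly2 S p)) : ℚ) * (2 * k))
      exact_mod_cast this
    linarith
  obtain ⟨bs, hbs, eb⟩ := exists_widen0 (pmem_ratPoly S q) hδS ρ
  refine ⟨bs, hbs, ?_⟩
  rw [eb, ← Poly.eval_eq_evalR, hδ]
  ring

/-! ### Strips: a column of consecutive boxes in `σ` of arbitrary rational half-widths -/

/-- Right end of the strip that starts at `ay` and stacks boxes of half-widths `ks`: `ay + 2Σks`. [folklore] -/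
def stripEnd (ay : ℚ) : List ℚ → ℚ
  | [] => ay
  | k :: ks => stripEnd (ay + 2 * k) ks

/-- Soundness of a box rule `Φ k cy` (half-width `k`, centre `cy`, the `ρ`-panel being fixed) for the integrand `f`
(already shifted to the `ρ`-panel): an accepted box model encloses `(u, v) ↦ f u (cy + v)` on `|u| ≤ h, |v| ≤ k`.
[cite: MakinoBerz2003, Algorithm 2] -/
def StripSound (S : ℕ) (h : ℚ) (f : ℝ → ℝ → ℝ) (Φ : ℚ → ℚ → IPoly2 × Bool) : Prop :=
  ∀ k cy : ℚ, (Φ k cy).2 = true → 0 ≤ k → TMem2 S h k (fun u v => f u ((cy : ℝ) + v)) (Φ k cy).1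

/-- **The strip model**: the sum of the partial-integral models of the boxes `[aⱼ, aⱼ + 2kⱼ]` (centres `aⱼ + kⱼ`), with the
conjunctive acceptance flag (every half-width positive, every box model accepted). [cite: MakinoBerz2003, Algorithm 2] -/
def stripTM (S : ℕ) (h : ℚ) (Φ : ℚ → ℚ → IPoly2 × Bool) (ay : ℚ) : List ℚ → IPoly × Bool
  | [] => ([], true)
  | k :: ks =>
      let m := Φ k (ay + k)
      let t := stripTM S h Φ (ay + 2 * k) ks
      (taddI (partialIntegTM S h k m.1) t.1, decide (0 < k) && m.2 && t.2)

/-- **Soundness of the strip model**: for a jointly measurable `f` and a sound box rule, an accepted strip model encloses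
`ρ ↦ ∫_{ay}^{stripEnd ay ks} f ρ y dy` on `|ρ| ≤ h`, and every such section is interval integrable on the strip.
[cite: MakinoBerz2003, Algorithm 2] [cite: MahboubiMelquiondSibutpinote2016, Sect. 3.3] -/
theorem tmem_stripTM {S : ℕ} (hS : 0 < S) {h : ℚ} (h0 : 0 ≤ h) {f : ℝ → ℝ → ℝ}
    (hm : Measurable fun z : ℝ × ℝ => f z.1 z.2) {Φ : ℚ → ℚ → IPoly2 × Bool} (hΦ : StripSound S h f Φ) :
    ∀ (ks : List ℚ) (ay : ℚ), (stripTM S h Φ ay ks).2 = true →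
      TMem S h (fun ρ => ∫ y in (ay : ℝ)..((stripEnd ay ks : ℚ) : ℝ), f ρ y) (stripTM S h Φ ay ks).1 ∧
        ∀ ρ : ℝ, |ρ| ≤ h → IntervalIntegrable (fun y => f ρ y) volume (ay : ℝ) ((stripEnd ay ks : ℚ) : ℝ)
  | [], ay, _ => by
      refine ⟨fun ρ _ => ⟨[], pmem_nil S, ?_⟩, fun ρ _ => ?_⟩
      · simp [stripEnd]
      · rw [show stripEnd ay [] = ay from rfl]
  | k :: ks, ay, hok => by
      simp only [stripTM, Bool.and_eq_true, decide_eq_true_eq] at hok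
      obtain ⟨⟨hk, hmok⟩, htok⟩ := hok
      have k0 : (0 : ℚ) ≤ k := hk.le
      -- the first box, shifted to its centre
      set cy : ℚ := ay + k with hcy
      have hg : Measurable fun z : ℝ × ℝ => f z.1 ((cy : ℝ) + z.2) :=
        hm.comp (measurable_fst.prodMk (measurable_snd.const_add (cy : ℝ)))
      obtain ⟨hT1, hI1⟩ := tmem_partialInteg hS h0 k0 hg (hΦ k cy hmok k0)
      obtain ⟨hT2, hI2⟩ := tmem_stripTM hS h0 hm hΦ ks (ay + 2 * k) htok
      have e1 : ((cy : ℝ) + -(k : ℝ)) = (ay : ℝ) := by rw [hcy]; push_cast; ring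
      have e2 : ((cy : ℝ) + (k : ℝ)) = (((ay + 2 * k : ℚ)) : ℝ) := by rw [hcy]; push_cast; ring
      -- integrability of the first box in the original variable
      have hI1' : ∀ ρ : ℝ, |ρ| ≤ h → IntervalIntegrable (fun y => f ρ y) volume (ay : ℝ) (((ay + 2 * k : ℚ)) : ℝ) := by
        intro ρ hρ
        have := (IntervalIntegrable.comp_add_left_iff (f := fun y => f ρ y) (c := (cy : ℝ))
          (a := (cy : ℝ) + -(k : ℝ)) (b := (cy : ℝ) + (k : ℝ))).1 ?_
        · rwa [e1, e2] at this
        · simpa [add_sub_cancel_left] using hI1 ρ hρ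
      refine ⟨fun ρ hρ => ?_, fun ρ hρ => (hI1' ρ hρ).trans (hI2 ρ hρ)⟩
      -- split the integral at `ay + 2k` and shift the first piece
      have hsplit : ∫ y in (ay : ℝ)..((stripEnd ay (k :: ks) : ℚ) : ℝ), f ρ y
          = (∫ v in (-(k : ℝ))..k, f ρ ((cy : ℝ) + v))
            + ∫ y in (((ay + 2 * k : ℚ)) : ℝ)..((stripEnd (ay + 2 * k) ks : ℚ) : ℝ), f ρ y := by
        rw [show stripEnd ay (k :: ks) = stripEnd (ay + 2 * k) ks from rfl,
          ← intervalIntegral.integral_add_adjacent_intervals (hI1' ρ hρ) (hI2 ρ hρ),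
          intervalIntegral.integral_comp_add_left (fun y => f ρ y) (cy : ℝ), e1, e2]
      have hsum := tmem_add hT1 hT2 ρ hρ
      obtain ⟨as, has, eas⟩ := hsum
      refine ⟨as, by simpa [stripTM] using has, ?_⟩
      beta_reduce
      rw [hsplit, ← eas]

/-! ### The vector form: one box pass, several integrands -/

/-- Component-wise soundness of a VECTOR box rule `Φ k cy : List IPoly2 × Bool` for the integrands `f 0, f 1, …, f (n−1)`:
an accepted pass returns `n` models, the `i`-th enclosing `(u, v) ↦ f i u (cy + v)`. [cite: MakinoBerz2003, Algorithm 2] -/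
def StripSoundV (S : ℕ) (h : ℚ) (n : ℕ) (f : ℕ → ℝ → ℝ → ℝ) (Φ : ℚ → ℚ → List IPoly2 × Bool) : Prop :=
  ∀ k cy : ℚ, (Φ k cy).2 = true → 0 ≤ k →
    (Φ k cy).1.length = n ∧ ∀ i : ℕ, i < n → TMem2 S h k (fun u v => f i u ((cy : ℝ) + v)) ((Φ k cy).1.getD i [])

/-- **The vector strip model**: `n` univariate models, the `i`-th being the sum over the boxes of the partial-integral models
of the `i`-th component. [cite: MakinoBerz2003, Algorithm 2] -/
def stripTMs (S : ℕ) (h : ℚ) (n : ℕ) (Φ : ℚ → ℚ → List IPoly2 × Bool) (ay : ℚ) : List ℚ → List IPoly × Bool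
  | [] => (List.replicate n [], true)
  | k :: ks =>
      let m := Φ k (ay + k)
      let t := stripTMs S h n Φ (ay + 2 * k) ks
      ((List.range n).map fun i => taddI (partialIntegTM S h k (m.1.getD i [])) (t.1.getD i []),
        decide (0 < k) && m.2 && t.2)

/-- [folklore] -/
private theorem getD_replicate_nil_strip (n i : ℕ) : (List.replicate n ([] : IPoly)).getD i [] = [] := by
  rw [List.getD_eq_getElem?_getD, List.getElem?_replicate]
  split <;> rfl

/-- [folklore] -/
private theorem getD_map_range_strip {α : Type*} (n : ℕ) (g : ℕ → α) (d : α) {i : ℕ} (hi : i < n) :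
    ((List.range n).map g).getD i d = g i := by
  rw [List.getD_eq_getElem?_getD, List.getElem?_map, List.getElem?_range hi]
  rfl

/-- **Soundness of the vector strip model** (component-wise). [cite: MakinoBerz2003, Algorithm 2]
[cite: MahboubiMelquiondSibutpinote2016, Sect. 3.3] -/
theorem tmem_stripTMs {S : ℕ} (hS : 0 < S) {h : ℚ} (h0 : 0 ≤ h) {n : ℕ} {f : ℕ → ℝ → ℝ → ℝ}
    (hm : ∀ i : ℕ, i < n → Measurable fun z : ℝ × ℝ => f i z.1 z.2) {Φ : ℚ → ℚ → List IPoly2 × Bool}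
    (hΦ : StripSoundV S h n f Φ) :
    ∀ (ks : List ℚ) (ay : ℚ), (stripTMs S h n Φ ay ks).2 = true → ∀ i : ℕ, i < n →
      TMem S h (fun ρ => ∫ y in (ay : ℝ)..((stripEnd ay ks : ℚ) : ℝ), f i ρ y) ((stripTMs S h n Φ ay ks).1.getD i []) ∧
        ∀ ρ : ℝ, |ρ| ≤ h → IntervalIntegrable (fun y => f i ρ y) volume (ay : ℝ) ((stripEnd ay ks : ℚ) : ℝ)
  | [], ay, _, i, hi => by
      refine ⟨fun ρ _ => ⟨[], ?_, ?_⟩, fun ρ _ => ?_⟩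
      · rw [show (stripTMs S h n Φ ay []).1 = List.replicate n [] from rfl, getD_replicate_nil_strip]; exact pmem_nil S
      · simp [stripEnd]
      · rw [show stripEnd ay [] = ay from rfl]
  | k :: ks, ay, hok, i, hi => by
      simp only [stripTMs, Bool.and_eq_true, decide_eq_true_eq] at hok
      obtain ⟨⟨hk, hmok⟩, htok⟩ := hok
      have k0 : (0 : ℚ) ≤ k := hk.le
      set cy : ℚ := ay + k with hcy
      have hg : Measurable fun z : ℝ × ℝ => f i z.1 ((cy : ℝ) + z.2) :=
        (hm i hi).comp (measurable_fst.prodMk (measurable_snd.const_add (cy : ℝ)))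
      obtain ⟨_, hcomp⟩ := hΦ k cy hmok k0
      obtain ⟨hT1, hI1⟩ := tmem_partialInteg hS h0 k0 hg (hcomp i hi)
      obtain ⟨hT2, hI2⟩ := tmem_stripTMs hS h0 hm hΦ ks (ay + 2 * k) htok i hi
      have e1 : ((cy : ℝ) + -(k : ℝ)) = (ay : ℝ) := by rw [hcy]; push_cast; ring
      have e2 : ((cy : ℝ) + (k : ℝ)) = (((ay + 2 * k : ℚ)) : ℝ) := by rw [hcy]; push_cast; ring
      have hI1' : ∀ ρ : ℝ, |ρ| ≤ h →
          IntervalIntegrable (fun y => f i ρ y) volume (ay : ℝ) (((ay + 2 * k : ℚ)) : ℝ) := by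
        intro ρ hρ
        have := (IntervalIntegrable.comp_add_left_iff (f := fun y => f i ρ y) (c := (cy : ℝ))
          (a := (cy : ℝ) + -(k : ℝ)) (b := (cy : ℝ) + (k : ℝ))).1 ?_
        · rwa [e1, e2] at this
        · simpa [add_sub_cancel_left] using hI1 ρ hρ
      refine ⟨fun ρ hρ => ?_, fun ρ hρ => (hI1' ρ hρ).trans (hI2 ρ hρ)⟩
      have hsplit : ∫ y in (ay : ℝ)..((stripEnd ay (k :: ks) : ℚ) : ℝ), f i ρ y
          = (∫ v in (-(k : ℝ))..k, f i ρ ((cy : ℝ) + v))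
            + ∫ y in (((ay + 2 * k : ℚ)) : ℝ)..((stripEnd (ay + 2 * k) ks : ℚ) : ℝ), f i ρ y := by
        rw [show stripEnd ay (k :: ks) = stripEnd (ay + 2 * k) ks from rfl,
          ← intervalIntegral.integral_add_adjacent_intervals (hI1' ρ hρ) (hI2 ρ hρ),
          intervalIntegral.integral_comp_add_left (fun y => f i ρ y) (cy : ℝ), e1, e2]
      obtain ⟨as, has, eas⟩ := tmem_add hT1 hT2 ρ hρ
      refine ⟨as, ?_, ?_⟩
      · simp only [stripTMs]
        rw [getD_map_range_strip n _ _ hi]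
        exact has
      · beta_reduce
        rw [hsplit, ← eas]

/-! ### Piecewise-certified strips

A long strip is too much work for ONE kernel `decide`; the pieces (sub-strips, typically single boxes) are certified SEPARATELY —
each as an equality `stripTMs … aⱼ [kⱼ, …] = (litⱼ, true)` with a literal model list — and only the literal lists are summed. -/

/-- Consecutive pieces: `starts = [a₀, a₁, …]`, piece `j` is the strip of half-widths `kss[j]` starting at `aⱼ`, `a₀ = a`,
`aⱼ₊₁ = stripEnd aⱼ kss[j]`, and the last piece ends at `b`. [cite: MahboubiMelquiondSibutpinote2016, Sect. 3.3] -/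
def piecesOK (a : ℚ) : List ℚ → List (List ℚ) → ℚ → Bool
  | [], [], b => decide (a = b)
  | s :: ss, ks :: kss, b => decide (s = a) && piecesOK (stripEnd a ks) ss kss b
  | _, _, _ => false

/-- Component-wise sum of the piece model lists (`n` components each). [cite: MakinoBerz2003, Algorithm 2] -/
def sumPieces (n : ℕ) : List (List IPoly) → List IPoly
  | [] => List.replicate n []
  | L :: Ls => (List.range n).map fun i => taddI (L.getD i []) ((sumPieces n Ls).getD i [])

/-- **Soundness of piecewise-certified strips**: if the pieces tile `[a, b]` and piece `j` of the vector strip model evaluates to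
the literal `lits[j]` with its flag accepted, then the component-wise sum of the literals encloses `ρ ↦ ∫_a^b f i ρ y dy` on
`|ρ| ≤ h`, component by component (with the interval integrability of the sections). [cite: MakinoBerz2003, Algorithm 2]
[cite: MahboubiMelquiondSibutpinote2016, Sect. 3.3] -/
theorem tmem_pieces {S : ℕ} (hS : 0 < S) {h : ℚ} (h0 : 0 ≤ h) {n : ℕ} {f : ℕ → ℝ → ℝ → ℝ}
    (hm : ∀ i : ℕ, i < n → Measurable fun z : ℝ × ℝ => f i z.1 z.2) {Φ : ℚ → ℚ → List IPoly2 × Bool}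
    (hΦ : StripSoundV S h n f Φ) :
    ∀ (starts : List ℚ) (kss : List (List ℚ)) (lits : List (List IPoly)) (a b : ℚ),
      piecesOK a starts kss b = true → lits.length = kss.length →
      (∀ j : ℕ, j < kss.length → stripTMs S h n Φ (starts.getD j 0) (kss.getD j []) = (lits.getD j [], true)) →
      ∀ i : ℕ, i < n →
        TMem S h (fun ρ => ∫ y in (a : ℝ)..(b : ℝ), f i ρ y) ((sumPieces n lits).getD i []) ∧
          ∀ ρ : ℝ, |ρ| ≤ h → IntervalIntegrable (fun y => f i ρ y) volume (a : ℝ) (b : ℝ)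
  | [], [], lits, a, b, hok, hlen, _, i, hi => by
      simp only [piecesOK, decide_eq_true_eq] at hok
      have hl : lits = [] := List.length_eq_zero_iff.mp (by simpa using hlen)
      subst hok; subst hl
      refine ⟨fun ρ _ => ⟨[], ?_, ?_⟩, fun ρ _ => ?_⟩
      · rw [show (sumPieces n ([] : List (List IPoly))) = List.replicate n [] from rfl, List.getD_eq_getElem?_getD,
          List.getElem?_replicate]
        split <;> exact pmem_nil S
      · simp
      · exact IntervalIntegrable.refl
  | [], _ :: _, _, _, _, hok, _, _, _, _ => by simp [piecesOK] at hok
  | _ :: _, [], _, _, _, hok, _, _, _, _ => by simp [piecesOK] at hok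
  | s :: ss, ks :: kss, lits, a, b, hok, hlen, hp, i, hi => by
      simp only [piecesOK, Bool.and_eq_true, decide_eq_true_eq] at hok
      obtain ⟨hs, hok'⟩ := hok
      obtain ⟨L, Ls, rfl⟩ : ∃ L Ls, lits = L :: Ls := by
        cases lits with
        | nil => simp at hlen
        | cons L Ls => exact ⟨L, Ls, rfl⟩
      have hlen' : Ls.length = kss.length := by simpa using hlen
      -- piece 0
      have h0p := hp 0 (by simp)
      simp only [List.getD_cons_zero] at h0p
      rw [hs] at h0p
      have hT0 := tmem_stripTMs hS h0 hm hΦ ks a (by rw [h0p]) i hi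
      rw [h0p] at hT0
      -- the remaining pieces
      have hrest := tmem_pieces hS h0 hm hΦ ss kss Ls (stripEnd a ks) b hok' hlen'
        (fun j hj => by simpa [List.getD_cons_succ] using hp (j + 1) (by simpa using hj)) i hi
      refine ⟨fun ρ hρ => ?_, fun ρ hρ => (hT0.2 ρ hρ).trans (hrest.2 ρ hρ)⟩
      obtain ⟨as, has, e⟩ := tmem_add hT0.1 hrest.1 ρ hρ
      refine ⟨as, ?_, ?_⟩
      · have : (sumPieces n (L :: Ls)).getD i [] = taddI (L.getD i []) ((sumPieces n Ls).getD i []) := by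
          show (((List.range n).map fun i => taddI (L.getD i []) ((sumPieces n Ls).getD i [])).getD i []) = _
          rw [List.getD_eq_getElem?_getD, List.getElem?_map, List.getElem?_range hi]; rfl
        rw [this]; exact has
      · beta_reduce
        rw [← intervalIntegral.integral_add_adjacent_intervals (hT0.2 ρ hρ) (hrest.2 ρ hρ), ← e]

/-! ### The instance for the code list `BExprT` -/

/-- The strip model of `ρ ↦ ∫_{ay}^{stripEnd ay ks} E(cx + ρ, y) dy` on `|ρ| ≤ h` for a `BExprT` integrand (one parameter record
`P` for all boxes of the strip). [cite: MakinoBerz2003, Algorithm 2] -/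
def stripTME (S : ℕ) (h : ℚ) (P : EPrm) (E : BExprT) (cx ay : ℚ) (ks : List ℚ) : IPoly × Bool :=
  stripTM S h (fun k cy => BExprT.model S h k P cx cy E) ay ks

/-- **Soundness for `BExprT` integrands** (no side hypotheses): an accepted strip model encloses the parametric integral
`ρ ↦ ∫_{ay}^{stripEnd ay ks} E(cx + ρ, y) dy` on `|ρ| ≤ h`. [cite: MakinoBerz2003, Algorithm 2] -/
theorem tmem_stripTME {S : ℕ} (hS : 0 < S) {h : ℚ} (h0 : 0 ≤ h) (P : EPrm) (E : BExprT) (cx ay : ℚ) (ks : List ℚ)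
    (hok : (stripTME S h P E cx ay ks).2 = true) :
    TMem S h (fun ρ => ∫ y in (ay : ℝ)..((stripEnd ay ks : ℚ) : ℝ), E.toFun₂ ((cx : ℝ) + ρ) y) (stripTME S h P E cx ay ks).1 ∧
      ∀ ρ : ℝ, |ρ| ≤ h →
        IntervalIntegrable (fun y => E.toFun₂ ((cx : ℝ) + ρ) y) volume (ay : ℝ) ((stripEnd ay ks : ℚ) : ℝ) := by
  have hm : Measurable fun z : ℝ × ℝ => E.toFun₂ ((cx : ℝ) + z.1) z.2 :=
    (BExprT.measurable_toFun₂ E).comp ((measurable_fst.const_add (cx : ℝ)).prodMk measurable_snd)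
  have hΦ : StripSound S h (fun u y => E.toFun₂ ((cx : ℝ) + u) y) (fun k cy => BExprT.model S h k P cx cy E) :=
    fun k cy hk k0 => BExprT.tmem2_model hS h0 k0 P cx cy E hk
  exact tmem_stripTM hS h0 hm hΦ ks ay hok

/-- The range of the parametric integral on the `ρ`-panel, read from an accepted strip model: if moreover
`lo·S ≤ tlowerI` and `tupperI ≤ hi·S`, then `lo ≤ ∫_{ay}^{stripEnd ay ks} E(cx + ρ, y) dy ≤ hi` for every `|ρ| ≤ h`.
[cite: MakinoBerz2003, Algorithm 2] -/
theorem integral_bounds_of_stripTME {S : ℕ} (hS : 0 < S) {h : ℚ} (h0 : 0 ≤ h) {P : EPrm} {E : BExprT} {cx ay : ℚ}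
    {ks : List ℚ} (hok : (stripTME S h P E cx ay ks).2 = true) {lo hi : ℚ}
    (hlo : lo * S ≤ tlowerI S h (stripTME S h P E cx ay ks).1) (hhi : tupperI S h (stripTME S h P E cx ay ks).1 ≤ hi * S)
    {ρ : ℝ} (hρ : |ρ| ≤ h) :
    (lo : ℝ) ≤ ∫ y in (ay : ℝ)..((stripEnd ay ks : ℚ) : ℝ), E.toFun₂ ((cx : ℝ) + ρ) y ∧
      ∫ y in (ay : ℝ)..((stripEnd ay ks : ℚ) : ℝ), E.toFun₂ ((cx : ℝ) + ρ) y ≤ (hi : ℝ) :=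
  bounds_of_tmem hS h0 (tmem_stripTME hS h0 P E cx ay ks hok).1 hlo hhi hρ

end PolyMP

end Literature.Analysis.ValidatedNumerics
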